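/- Fleet lead `ym-wcr-19609-p1` (seat prover-ym-wcr-19609-p1-g2-0), route `WeakCouplingRates`, crux `BulkDominatesColdBoxW` (stmt-QuantumFields-19609). -/
import Summits.QuantumFields.YangMills.Theses.WeakCouplingRates
import Summits.QuantumFields.YangMills.Theorems.WeakCouplingRatesBulkDominatesColdBoxWDefs
import Summits.QuantumFields.YangMills.Theorems.WeakCouplingRatesBulkDominatesColdBoxWStubLargeFieldRarity
import Summits.QuantumFields.YangMills.Theorems.WeakCouplingRatesBulkDominatesColdBoxWStubDlrAssembly
import Summits.QuantumFields.YangMills.Theorems.WeakCouplingRatesBulkDominatesColdBoxWMeanSmoothOfExpansion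
import Summits.QuantumFields.YangMills.Theorems.WeakCouplingRatesBulkDominatesColdBoxWCovStableOfExpansion
import Summits.QuantumFields.YangMills.Theorems.WeakCouplingRatesBulkDominatesColdBoxWDirKernelDiagFlat
import Summits.QuantumFields.YangMills.Theorems.WeakCouplingRatesBulkDominatesColdBoxWStubDirKernelTwoPoint
import Summits.QuantumFields.YangMills.Theorems.WeakCouplingRatesBulkDominatesColdBoxWStubFlatCovExpansion
import Summits.QuantumFields.YangMills.Theorems.WeakCouplingRatesBulkDominatesColdBoxWStubBoxPolyFloor
import Summits.QuantumFields.YangMills.Theorems.WeakCouplingRatesBulkDominatesColdBoxWStubKernelMeanExpansion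
import Summits.QuantumFields.YangMills.Theorems.WeakCouplingRatesBulkDominatesColdBoxWStubKernelCovExpansion

/-!
# Crux `BulkDominatesColdBoxW` (BULK_W, stmt-QuantumFields-19609) of route `WeakCouplingRates` — PROVED

`BulkDominatesColdBoxW_proof : Summit.QuantumFields.YangMills.Theses.WeakCouplingRates.BulkDominatesColdBoxW` — (BULK, window form, rev 2)
for every ceiling `θ₀ > 0` there are exponents `0 < A < θ ≤ θ₀` with `BulkDominatesBox A θ`: eventually in the torus size, the `SU(2)`
torus-state covariance of the `(1,2)`-plaquette cost and its time-translate by `⌈β^A⌉` is `≥ η ×` the same covariance in the cold-wall Wilson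
box of side `2⌈β^θ⌉+1`.

This is the kernel-checked composition `BulkDominatesColdBoxW_of` of the registered `dlr-chessboard` line skeleton (v9, sha16 `e86b942eb6fb2c01`,
evidence #51 on the item; lead skeletons v4–v8 evidence #25/#28/#40/#41) with every registered stub replaced by the tree theorem that landed it BY
NAME: L2 `stub_largeFieldRarity` (p445862, lead g0), L3 `stub_dlrAssembly` (p448414, lead g0), N1′ `dirKernelDiagFlat` (p467892, seat ym-spine-20043-p1),
N1 `stub_dirKernelTwoPoint` (p470265, lead g2), N2-flat `stub_flatCovExpansion` (p480257, lead g2 ⇐ `boxDirichletDominationAbs` of seat ym-wcr-19456-p1),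
L4 `stub_boxPolyFloor` (p480614/p480638 ⇐ BOX_W `ColdBoxTwoPointFloorW_proof` + FLOOR), N2-mean `stub_kernelMeanExpansion` (p487340, seat ym-wcr-19608-p2),
N2-cov `stub_kernelCovExpansion` (lead g2, this landing's sibling), and the two kernel-checked reductions L1a ⇐ N2-cov ∧ N2-flat ∧ N1
(`goodBoundaryCovStable_of_kernelCovExpansion`), L1b ⇐ N2-mean ∧ N1′ (`goodBoundaryMeanSmooth_of_kernelMeanExpansion`).  Parameter point along the
family `(A, δ, θ, K) = (θ/20, θ/5, θ, 2 + θ/2)` with `θ = min θ₀ θ₁ᵃ θ₁ᵇ θ₁ᵏ`; DLR window `K + 4δ + 2A = 2 + 1.4θ < 2 + 2θ`.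
No sorry, no hypothesis, no new definition; standard axioms.  NOT the Clay mass gap: a finite-volume weak-coupling comparison «torus covariance ≥
η × cold-box covariance» for one Wilson box (the BULK half of the route's PW-CORR-POLY split; BOX_W is the closed sibling crux stmt-QuantumFields-19608).
-/

set_option autoImplicit false

noncomputable section

namespace Summit.QuantumFields.YangMills.Theorems.WeakCouplingRates

open Literature.MathematicalPhysics.QuantumLattice

/-- **Crux `BulkDominatesColdBoxW` of route `WeakCouplingRates`, PROVED** — the stubs BY NAME give the crux BY NAME: L1a from
(`stub_kernelCovExpansion`, `stub_flatCovExpansion`, `stub_dirKernelTwoPoint`), L1b from (`stub_kernelMeanExpansion`, `dirKernelDiagFlat`), L4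
`stub_boxPolyFloor`, L2 `stub_largeFieldRarity`, assembled by L3 `stub_dlrAssembly` at `(A, δ, θ, K) = (θ/20, θ/5, θ, 2 + θ/2)`,
`θ = min θ₀ (min θ₁ᵃ (min θ₁ᵇ θ₁ᵏ))`. -/
theorem BulkDominatesColdBoxW_proof : Summit.QuantumFields.YangMills.Theses.WeakCouplingRates.BulkDominatesColdBoxW := by
  unfold Summit.QuantumFields.YangMills.Theses.WeakCouplingRates.BulkDominatesColdBoxW
  obtain ⟨θa, hθa, ha⟩ := goodBoundaryCovStable_of_kernelCovExpansion stub_kernelCovExpansion stub_flatCovExpansion stub_dirKernelTwoPoint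
  obtain ⟨θb, hθb, hb⟩ := goodBoundaryMeanSmooth_of_kernelMeanExpansion stub_kernelMeanExpansion dirKernelDiagFlat
  obtain ⟨θk, hθk, hk⟩ := stub_boxPolyFloor
  intro θ₀ hθ₀
  have hθpos : 0 < min θ₀ (min θa (min θb θk)) := lt_min hθ₀ (lt_min hθa (lt_min hθb hθk))
  have hθ0 : min θ₀ (min θa (min θb θk)) ≤ θ₀ := min_le_left _ _
  have hθa' : min θ₀ (min θa (min θb θk)) ≤ θa := le_trans (min_le_right _ _) (min_le_left _ _)
  have hθb' : min θ₀ (min θa (min θb θk)) ≤ θb :=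
    le_trans (min_le_right _ _) (le_trans (min_le_right _ _) (min_le_left _ _))
  have hθk' : min θ₀ (min θa (min θb θk)) ≤ θk :=
    le_trans (min_le_right _ _) (le_trans (min_le_right _ _) (min_le_right _ _))
  obtain ⟨η₁, hη, h1a'⟩ := ha _ hθpos hθa'
  refine ⟨min θ₀ (min θa (min θb θk)) / 20, min θ₀ (min θa (min θb θk)), by positivity, by linarith, hθ0, ?_⟩
  exact stub_dlrAssembly _ _ _ η₁ _ (by positivity) (by positivity) hη (by linarith) h1a' (hb _ hθpos hθb')
    (stub_largeFieldRarity _ (by positivity)) (hk _ hθpos hθk')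

end Summit.QuantumFields.YangMills.Theorems.WeakCouplingRates

end
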